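import Literature.Combinatorics.Designs.BaseSequences

/-!
# Elementary transformations of Turyn-type sequences (negation, reversal, alternation, interchange)

[Best–Đoković–Kharaghani–Ramp, J. Combin. Des. 21 (2013) 24–35 = arXiv:1206.4107] (`BestDjokovicKharaghaniRamp2013`), §2:
for a sequence `A = a₁, …, a_n` the negated sequence `-A`, the reversed sequence `A' = a_n, …, a₁` and the alternated
sequence `A* = a₁, -a₂, a₃, …, (-1)^{n-1} a_n` satisfy `N(-A) = N(A') = N(A)` and `N_{A*}(i) = (-1)^i N_A(i)`; hence
the four ELEMENTARY TRANSFORMATIONS of `(A; B; C; D) ∈ TT(n)` — (T1) negate one of `A, B, C, D`; (T2) reverse one of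
`A, B, C, D`; (T3) alternate all four sequences; (T4) interchange `A` and `B` — map `TT(n)` to `TT(n)`.  They generate
the equivalence relation (a group of order `2^10`, §3) behind the canonical form and the classification for `n ≤ 32`
([Seberry–Yamada 2020] (`SeberryYamada2020`) Lemma 1.20 is the reversal identity, Lemma 1.22 (ii) negation).

PROVED here for sequences `ℕ → ℤ` with explicit length (the conventions of `TSequences` / `BaseSequences`):
`npaf_rev` (`N(A') = N(A)`), `npaf_alt` (`N_{A*}(s) = (-1)^s N_A(s)`), and the invariance of `IsTurynType n` under
(T1) `turynType_neg₁…₄`, (T2) `turynType_rev₁…₄`, (T3) `turynType_alt`, (T4) `turynType_swap`.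
Cell pub-namedobj (venture DiscreteObjects), target H: the symmetry group any enumeration or SAT encoding of `TT(56)`
quotients by.  No `sorry`, no new axioms.
-/

open Finset BigOperators

namespace Literature.Combinatorics.Designs.TurynTypeSymmetries

open Literature.Combinatorics.Designs.TSequences
open Literature.Combinatorics.Designs.BaseSequences

/-! ## The three operations on a sequence of length `n` -/

/-- the negated sequence `-A`. [cite: BestDjokovicKharaghaniRamp2013, §2] -/
def neg (x : ℕ → ℤ) : ℕ → ℤ := fun i => -x i

/-- the reversed sequence `A' = a_n, …, a₁` of a sequence of length `n`. [cite: BestDjokovicKharaghaniRamp2013, §2] -/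
def rev (n : ℕ) (x : ℕ → ℤ) : ℕ → ℤ := fun i => x (n - 1 - i)

/-- the alternated sequence `A* = a₁, -a₂, a₃, …` (entry `i`, counted from `0`, multiplied by `(-1)^i`).
[cite: BestDjokovicKharaghaniRamp2013, §2] -/
def alt (x : ℕ → ℤ) : ℕ → ℤ := fun i => (-1) ^ i * x i

/-- negation preserves `±1` entries. [cite: BestDjokovicKharaghaniRamp2013, §2] -/
lemma pmOn_neg {n : ℕ} {x : ℕ → ℤ} (h : PMOn n x) : PMOn n (neg x) := by
  intro i hi
  rcases h i hi with e | e <;> simp [neg, e]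

/-- reversal preserves `±1` entries. [cite: BestDjokovicKharaghaniRamp2013, §2] -/
lemma pmOn_rev {n : ℕ} {x : ℕ → ℤ} (h : PMOn n x) : PMOn n (rev n x) := by
  intro i hi
  exact h (n - 1 - i) (by omega)

/-- alternation preserves `±1` entries. [cite: BestDjokovicKharaghaniRamp2013, §2] -/
lemma pmOn_alt {n : ℕ} {x : ℕ → ℤ} (h : PMOn n x) : PMOn n (alt x) := by
  intro i hi
  rcases neg_one_pow_eq_or ℤ i with e | e <;> rcases h i hi with f | f <;> simp [alt, e, f]

/-! ## Their effect on the aperiodic autocorrelation -/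

/-- `N(-A) = N(A)`. [cite: BestDjokovicKharaghaniRamp2013, §2] -/
theorem npaf_neg' (n : ℕ) (x : ℕ → ℤ) (s : ℕ) : NPAF n (neg x) s = NPAF n x s := by
  simp [NPAF, neg]

/-- `N(A') = N(A)` (SY 2020 Lemma 1.20). [cite: BestDjokovicKharaghaniRamp2013, §2] -/
theorem npaf_rev (n : ℕ) (x : ℕ → ℤ) (s : ℕ) : NPAF n (rev n x) s = NPAF n x s := by
  unfold NPAF rev
  rw [← Finset.sum_range_reflect (fun j => x j * x (j + s)) (n - s)]
  refine sum_congr rfl fun i hi => ?_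
  rw [mem_range] at hi
  rw [mul_comm]
  congr 2 <;> omega

/-- `N_{A*}(s) = (-1)^s N_A(s)`. [cite: BestDjokovicKharaghaniRamp2013, §2] -/
theorem npaf_alt (n : ℕ) (x : ℕ → ℤ) (s : ℕ) : NPAF n (alt x) s = (-1) ^ s * NPAF n x s := by
  unfold NPAF alt
  rw [Finset.mul_sum]
  refine sum_congr rfl fun i _ => ?_
  have h2 : ((-1 : ℤ) ^ i) ^ 2 = 1 := by
    rw [← pow_mul, mul_comm, pow_mul]
    simp
  calc (-1) ^ i * x i * ((-1) ^ (i + s) * x (i + s))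
      = ((-1 : ℤ) ^ i) ^ 2 * ((-1) ^ s * (x i * x (i + s))) := by ring
    _ = (-1) ^ s * (x i * x (i + s)) := by rw [h2, one_mul]

/-! ## The elementary transformations (T1)–(T4) preserve `TT(n)` -/

section TT

variable {n : ℕ} {x y z w : ℕ → ℤ}

/-- (T1) negate `A`. [cite: BestDjokovicKharaghaniRamp2013, §2 (T1)] -/
theorem turynType_neg₁ (h : IsTurynType n x y z w) : IsTurynType n (neg x) y z w := by
  obtain ⟨hx, hy, hz, hw, hN⟩ := h
  exact ⟨pmOn_neg hx, hy, hz, hw, fun s hs hs0 => by rw [npaf_neg']; exact hN s hs hs0⟩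

/-- (T1) negate `B`. [cite: BestDjokovicKharaghaniRamp2013, §2 (T1)] -/
theorem turynType_neg₂ (h : IsTurynType n x y z w) : IsTurynType n x (neg y) z w := by
  obtain ⟨hx, hy, hz, hw, hN⟩ := h
  exact ⟨hx, pmOn_neg hy, hz, hw, fun s hs hs0 => by rw [npaf_neg']; exact hN s hs hs0⟩

/-- (T1) negate `C`. [cite: BestDjokovicKharaghaniRamp2013, §2 (T1)] -/
theorem turynType_neg₃ (h : IsTurynType n x y z w) : IsTurynType n x y (neg z) w := by
  obtain ⟨hx, hy, hz, hw, hN⟩ := h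
  exact ⟨hx, hy, pmOn_neg hz, hw, fun s hs hs0 => by rw [npaf_neg']; exact hN s hs hs0⟩

/-- (T1) negate `D`. [cite: BestDjokovicKharaghaniRamp2013, §2 (T1)] -/
theorem turynType_neg₄ (h : IsTurynType n x y z w) : IsTurynType n x y z (neg w) := by
  obtain ⟨hx, hy, hz, hw, hN⟩ := h
  exact ⟨hx, hy, hz, pmOn_neg hw, fun s hs hs0 => by rw [npaf_neg']; exact hN s hs hs0⟩

/-- (T2) reverse `A`. [cite: BestDjokovicKharaghaniRamp2013, §2 (T2)] -/
theorem turynType_rev₁ (h : IsTurynType n x y z w) : IsTurynType n (rev n x) y z w := by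
  obtain ⟨hx, hy, hz, hw, hN⟩ := h
  exact ⟨pmOn_rev hx, hy, hz, hw, fun s hs hs0 => by rw [npaf_rev]; exact hN s hs hs0⟩

/-- (T2) reverse `B`. [cite: BestDjokovicKharaghaniRamp2013, §2 (T2)] -/
theorem turynType_rev₂ (h : IsTurynType n x y z w) : IsTurynType n x (rev n y) z w := by
  obtain ⟨hx, hy, hz, hw, hN⟩ := h
  exact ⟨hx, pmOn_rev hy, hz, hw, fun s hs hs0 => by rw [npaf_rev]; exact hN s hs hs0⟩

/-- (T2) reverse `C`. [cite: BestDjokovicKharaghaniRamp2013, §2 (T2)] -/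
theorem turynType_rev₃ (h : IsTurynType n x y z w) : IsTurynType n x y (rev n z) w := by
  obtain ⟨hx, hy, hz, hw, hN⟩ := h
  exact ⟨hx, hy, pmOn_rev hz, hw, fun s hs hs0 => by rw [npaf_rev]; exact hN s hs hs0⟩

/-- (T2) reverse `D` (length `n - 1`). [cite: BestDjokovicKharaghaniRamp2013, §2 (T2)] -/
theorem turynType_rev₄ (h : IsTurynType n x y z w) : IsTurynType n x y z (rev (n - 1) w) := by
  obtain ⟨hx, hy, hz, hw, hN⟩ := h
  exact ⟨hx, hy, hz, pmOn_rev hw, fun s hs hs0 => by rw [npaf_rev]; exact hN s hs hs0⟩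

/-- (T3) alternate all four sequences: `Σ (-1)^s (…) = (-1)^s · 0`. [cite: BestDjokovicKharaghaniRamp2013, §2 (T3)] -/
theorem turynType_alt (h : IsTurynType n x y z w) : IsTurynType n (alt x) (alt y) (alt z) (alt w) := by
  obtain ⟨hx, hy, hz, hw, hN⟩ := h
  refine ⟨pmOn_alt hx, pmOn_alt hy, pmOn_alt hz, pmOn_alt hw, fun s hs hs0 => ?_⟩
  rw [npaf_alt, npaf_alt, npaf_alt, npaf_alt]
  have := hN s hs hs0
  calc (-1) ^ s * NPAF n x s + (-1) ^ s * NPAF n y s + 2 * ((-1) ^ s * NPAF n z s) +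
        2 * ((-1) ^ s * NPAF (n - 1) w s)
      = (-1) ^ s * (NPAF n x s + NPAF n y s + 2 * NPAF n z s + 2 * NPAF (n - 1) w s) := by ring
    _ = 0 := by rw [this, mul_zero]

/-- (T4) interchange `A` and `B`. [cite: BestDjokovicKharaghaniRamp2013, §2 (T4)] -/
theorem turynType_swap (h : IsTurynType n x y z w) : IsTurynType n y x z w := by
  obtain ⟨hx, hy, hz, hw, hN⟩ := h
  exact ⟨hy, hx, hz, hw, fun s hs hs0 => by rw [add_comm (NPAF n y s)]; exact hN s hs hs0⟩

end TT

end Literature.Combinatorics.Designs.TurynTypeSymmetries
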